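import Literature.Probability.RandomPlanarGeometry.SLEBubblesVersionProofs
import Literature.Probability.RandomPlanarGeometry.SLEBubblesAvoidanceProofs
import Literature.Probability.RandomPlanarGeometry.SLEBubblesConfig
import Literature.Probability.RandomPlanarGeometry.SLEBubblesAssembly
import Literature.Probability.RandomPlanarGeometry.RohdeSchrammCor35Proofs
import Literature.Probability.RandomPlanarGeometry.CritPercSLESimplePathProofs
import Literature.Probability.Process.PoissonCloudProofs
import HarnessLib

/-!
# `{Ξ(κ) ∩ A = ∅}` is an event — discharge of `SLEBubbles.nullMeasurableSet_disjoint`; [LSW] Thm. 7.3 and the `α > 5/8` leaf from the three remaining inputs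

Proof-only file (no new definition, no new named fact), after

* G. F. Lawler, O. Schramm, W. Werner, *Conformal restriction: the chordal case*, J. Amer. Math.
  Soc. **16** (2003) 917–955, arXiv:math/0209343 (**[LSW]**, arXiv page numbers), §7.2 and
  Thm. 7.3 (pp. 28–29: "Since `κ ≤ 8/3`, we know from [RS] that `γ` is a simple curve";
  "`P[Ξ ∩ A = ∅] = Φ_A'(0)^α`" (7.3); "all that remains is to show that `cl Ξ = Ξ ∪ {0}`"), and
  the sentence after its proof (p. 29: "for all `α > 5/8`, the measure `P_α` exists and can be
  constructed by adding bubbles with appropriate intensity to SLE_κ with `κ = 6/(2α + 1)`");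
* S. Rohde, O. Schramm, *Basic properties of SLE*, Ann. of Math. **161** (2005), Thm. 5.1 (SLE_κ,
  `κ ≠ 8`, is generated by a curve) and Thm. 6.1 (the trace is a simple path for `κ ≤ 4`) — both
  now THEOREMS of the tree (`hasSLETrace_of_ne_eight_holds`, `RohdeSchrammCor35Proofs`;
  `ae_isSimpleTrace_sleTrace_of_le_four_of_hasSLETrace_fact`, `CritPercSLESimplePathProofs`).

`SLEBubblesVersionProofs` proved the measurability half of Thm. 7.3
(`SLEBubbles.nullMeasurableSet_disjoint`: `{Ξ(κ) ∩ A = ∅}` is null-measurable for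
`preWienerMeasure ⊗ P'`) CONDITIONALLY on the Rohde–Schramm trace theorem
(`SLEBubbles.nullMeasurableSet_disjoint_of_hasSLETrace_of_ne_eight`), which has since been
discharged. Hence:

* `SLEBubbles.nullMeasurableSet_disjoint_holds` — **the discharge**;
* `SLEBubbles.measure_disjoint_of_thm65` — the avoidance formula (7.3)
  (`SLEBubbles.measure_disjoint`) from the Theorem 6.5 fact ALONE
  (`SLEBubbles.lintegral_poissonAvoidance_eq_rpow`), the measurability of `s_ω` being
  discharged too (`SLEBubbles.ae_measurableSet_bubbleHitSet_holds`, `SLEBubblesAvoidanceProofs`);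
* `SLEBubbles.ae_mem_restrictionConfigs_of_closedness`,
  `SLEBubbles.exists_measurable_version_of_closedness` — the sample-path half of Thm. 7.3
  (`Ξ(κ) ∈ Ω` a.s., resp. the measurable `Ω`-valued version) from the two almost sure statements
  isolated in `SLEBubblesConfig` and nothing else: the printed closedness `cl Ξ = Ξ ∪ {0}` of
  p. 29 (`hcl`) and condition (2) of Def. 3.1 for `Ξ` (`hcc`, implicit in [LSW]) — the
  simple-path input `hRS` of `SLEBubbles.ae_mem_restrictionConfigs_of_forall_closure` is fed by
  Rohde–Schramm's theorems;
* `IsRestrictionMeasure.ae_interior_nonempty_of_gt_five_eighths_of_three_leaves` /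
  `…_of_closedness`, `exists_isRestrictionMeasure_ae_interior_nonempty_of_three_leaves` — the
  `α > 5/8` leaf of [LSW] p. 5 result 2 (`IsRestrictionMeasure.ae_interior_nonempty_of_gt_five_eighths`,
  file `RestrictionMeasuresFiveEighths`: `P_α`-a.e. `K` has an interior point for `α > 5/8`) and
  its existential form (`exists_isRestrictionMeasure_ae_interior_nonempty`,
  `RestrictionMeasuresBubbles`) from the THREE inputs that remain of the four-fact assembly
  `IsRestrictionMeasure.ae_interior_nonempty_of_gt_five_eighths_of_bubbles'` (`SLEBubblesAssembly`)
  now that Kingman's existence theorem (`exists_isPoissonCloud_holds`, `Process/PoissonCloudProofs`),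
  the Rohde–Schramm theorem and the measurability statements are proved: (1) a Brownian bubble
  measure with interior points (`exists_isBrownianBubbleMeasure_ae_interior_nonempty`, §7.1);
  (2) `Ξ(κ) ∈ Ω` a.s. (`SLEBubbles.ae_mem_restrictionConfigs`, equivalently `hcl` + `hcc`);
  (3) Theorem 6.5 (`SLEBubbles.lintegral_poissonAvoidance_eq_rpow`).

So `IsRestrictionMeasure.ae_interior_nonempty_of_gt_five_eighths_holds` is exactly
`…_of_three_leaves` applied to the three `_holds` theorems of these facts, once they exist.

Mathlib: none beyond the imports. Tree: the reductions quoted above.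
-/

noncomputable section

open Set Filter Topology MeasureTheory
open scoped NNReal ENNReal
open Literature.Probability.Process (preWienerMeasure IsPoissonCloud exists_isPoissonCloud
  exists_isPoissonCloud_holds)

namespace Literature.Probability.RandomPlanarGeometry

/-! ### The Rohde–Schramm inputs of §7.2, as theorems -/

/-- **"Since `κ ≤ 8/3`, we know from [RS] that `γ` is a simple curve"** ([LSW] p. 28): for every
`κ`, the simple-path fact `ae_isSimpleTrace_sleTrace_of_le_four` (Rohde–Schramm Thm. 6.1,
`0 < κ ≤ 4`) holds, from the discharged trace theorem `hasSLETrace_of_ne_eight_holds` through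
`ae_isSimpleTrace_sleTrace_of_le_four_of_hasSLETrace_fact`. [cite: RohdeSchramm2005, Thm 6.1] -/
theorem SLEBubbles.ae_isSimpleTrace_sleTrace (κ : ℝ≥0) :
    ae_isSimpleTrace_sleTrace_of_le_four (κ := κ) :=
  ae_isSimpleTrace_sleTrace_of_le_four_of_hasSLETrace_fact hasSLETrace_of_ne_eight_holds

/-- **DISCHARGE of `SLEBubbles.nullMeasurableSet_disjoint`** — the avoidance sets
`{(ω, ω') : Ξ(κ) ∩ A = ∅}`, `A ∈ 𝒬*`, of [LSW] Thm. 7.3 are null-measurable for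
`preWienerMeasure ⊗ P'` (what the left-hand side of (7.3) presupposes): the conditional proof
`SLEBubbles.nullMeasurableSet_disjoint_of_hasSLETrace_of_ne_eight` of `SLEBubblesVersionProofs`
(`{Ξ ∩ A = ∅} = {γ ∩ A = ∅} ∩ {X ∩ s_ω = ∅}`, the first null-measurable by continuity of the
trace once its marginals are a.e.-measurable, the second unconditionally) fed with the
Rohde–Schramm trace theorem `hasSLETrace_of_ne_eight_holds`.
[cite: LawlerSchrammWerner2003Restriction, Thm. 7.3 with eq. (7.3) (p. 29)] -/
theorem SLEBubbles.nullMeasurableSet_disjoint_holds : SLEBubbles.nullMeasurableSet_disjoint :=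
  SLEBubbles.nullMeasurableSet_disjoint_of_hasSLETrace_of_ne_eight hasSLETrace_of_ne_eight_holds

/-! ### (7.3) from Theorem 6.5 alone -/

/-- **[LSW] (7.3) from Theorem 6.5 alone**: the avoidance formula
`P[Ξ(κ) ∩ A = ∅] = Φ'_A(0)^{α_κ}` (`SLEBubbles.measure_disjoint`) follows from the Thm. 6.5 fact
`SLEBubbles.lintegral_poissonAvoidance_eq_rpow`, the two measurability inputs of
`SLEBubbles.measure_disjoint_of_leaves` being theorems (`SLEBubbles.nullMeasurableSet_disjoint_holds`,
`SLEBubbles.ae_measurableSet_bubbleHitSet_holds`).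
[cite: LawlerSchrammWerner2003Restriction, Thm. 7.3 with eq. (7.3) (pp. 28–29) and Thm. 6.5] -/
theorem SLEBubbles.measure_disjoint_of_thm65 (h65 : SLEBubbles.lintegral_poissonAvoidance_eq_rpow) :
    SLEBubbles.measure_disjoint :=
  SLEBubbles.measure_disjoint_of_two_leaves SLEBubbles.nullMeasurableSet_disjoint_holds h65

/-! ### `Ξ(κ) ∈ Ω` and the measurable version from the two almost sure statements of p. 29 -/

/-- **`Ξ(κ) ∈ Ω` almost surely, from the closedness statement of p. 29 and Def. 3.1 (2)**: the
sample-path leaf `SLEBubbles.ae_mem_restrictionConfigs` follows from `cl Ξ = Ξ ∪ {0}` a.s.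
(`hcl`, [LSW] p. 29: "all that remains is to show that `cl Ξ = Ξ ∪ {0}`") and the a.s.
connectedness of `ℂ ∖ cl Ξ` (`hcc`, Def. 3.1 (2), implicit in the statement of Thm. 7.3), by
`SLEBubbles.ae_mem_restrictionConfigs_of_forall_closure` with the Rohde–Schramm simple-path
input discharged (`SLEBubbles.ae_isSimpleTrace_sleTrace`).
[cite: LawlerSchrammWerner2003Restriction, Thm. 7.3 and end of its proof (p. 29), with Def. 3.1 (p. 10)] -/
theorem SLEBubbles.ae_mem_restrictionConfigs_of_closedness
    (hcl : ∀ {κ : ℝ≥0}, 0 < κ → κ ≤ 8 / 3 → ∀ {μ : Measure BubbleConfig}, IsBrownianBubbleMeasure μ →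
      ∀ {Ω' : Type} [MeasurableSpace Ω'] {P' : Measure Ω'} {X : Ω' → Set (BubbleConfig × ℝ≥0)},
        IsPoissonCloud (bubbleCloudIntensity κ μ) X P' →
          ∀ᵐ p ∂(preWienerMeasure.prod P'),
            closure (sleBubbleSet κ p.1 (X p.2)) = sleBubbleSet κ p.1 (X p.2) ∪ {0})
    (hcc : ∀ {κ : ℝ≥0}, 0 < κ → κ ≤ 8 / 3 → ∀ {μ : Measure BubbleConfig}, IsBrownianBubbleMeasure μ →
      ∀ {Ω' : Type} [MeasurableSpace Ω'] {P' : Measure Ω'} {X : Ω' → Set (BubbleConfig × ℝ≥0)},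
        IsPoissonCloud (bubbleCloudIntensity κ μ) X P' →
          ∀ᵐ p ∂(preWienerMeasure.prod P'), IsConnected (closure (sleBubbleSet κ p.1 (X p.2)))ᶜ) :
    SLEBubbles.ae_mem_restrictionConfigs :=
  SLEBubbles.ae_mem_restrictionConfigs_of_forall_closure SLEBubbles.ae_isSimpleTrace_sleTrace hcl hcc

/-- **`Ξ(κ)` has a measurable `Ω`-valued version, from the same two almost sure statements**
(the named fact `SLEBubbles.exists_measurable_version`, [LSW] Thm. 7.3: `Ξ(κ)` is a random
element of `Ω`): `SLEBubbles.exists_measurable_version_of_closure` with the Rohde–Schramm input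
and the measurability leaf discharged.
[cite: LawlerSchrammWerner2003Restriction, Thm. 7.3 (p. 29) with Def. 3.1 (p. 10) and §3 p. 10] -/
theorem SLEBubbles.exists_measurable_version_of_closedness
    (hcl : ∀ {κ : ℝ≥0}, 0 < κ → κ ≤ 8 / 3 → ∀ {μ : Measure BubbleConfig}, IsBrownianBubbleMeasure μ →
      ∀ {Ω' : Type} [MeasurableSpace Ω'] {P' : Measure Ω'} {X : Ω' → Set (BubbleConfig × ℝ≥0)},
        IsPoissonCloud (bubbleCloudIntensity κ μ) X P' →
          ∀ᵐ p ∂(preWienerMeasure.prod P'),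
            closure (sleBubbleSet κ p.1 (X p.2)) = sleBubbleSet κ p.1 (X p.2) ∪ {0})
    (hcc : ∀ {κ : ℝ≥0}, 0 < κ → κ ≤ 8 / 3 → ∀ {μ : Measure BubbleConfig}, IsBrownianBubbleMeasure μ →
      ∀ {Ω' : Type} [MeasurableSpace Ω'] {P' : Measure Ω'} {X : Ω' → Set (BubbleConfig × ℝ≥0)},
        IsPoissonCloud (bubbleCloudIntensity κ μ) X P' →
          ∀ᵐ p ∂(preWienerMeasure.prod P'), IsConnected (closure (sleBubbleSet κ p.1 (X p.2)))ᶜ) :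
    SLEBubbles.exists_measurable_version :=
  SLEBubbles.exists_measurable_version_of_closure SLEBubbles.ae_isSimpleTrace_sleTrace hcl hcc
    SLEBubbles.nullMeasurableSet_disjoint_holds

/-- **The measurable version from the sample-path leaf alone**: `SLEBubbles.exists_measurable_version`
from `SLEBubbles.ae_mem_restrictionConfigs`, the measurability leaf being discharged
(`SLEBubbles.exists_measurable_version_of_leaves`).
[cite: LawlerSchrammWerner2003Restriction, Thm. 7.3 (p. 29) with §3 p. 10] -/
theorem SLEBubbles.exists_measurable_version_of_ae_mem (hcfg : SLEBubbles.ae_mem_restrictionConfigs) :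
    SLEBubbles.exists_measurable_version :=
  SLEBubbles.exists_measurable_version_of_leaves hcfg SLEBubbles.nullMeasurableSet_disjoint_holds

/-! ### The `α > 5/8` leaf from the three remaining inputs -/

/-- **`P_α`-a.e. `K` has an interior point for `α > 5/8`, from three inputs** — the named fact
`IsRestrictionMeasure.ae_interior_nonempty_of_gt_five_eighths` ([LSW] Thm. 7.3 and p. 29 with
Prop. 3.3) from (1) a Brownian bubble measure with interior points (`hμex`, §7.1), (2)
`Ξ(κ) ∈ Ω` a.s. (`hcfg`, the sample-path half of Thm. 7.3) and (3) Theorem 6.5 (`h65`): the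
four-fact assembly `IsRestrictionMeasure.ae_interior_nonempty_of_gt_five_eighths_of_bubbles'`
with Kingman's existence theorem (`exists_isPoissonCloud_holds`), the measurable version
(`SLEBubbles.exists_measurable_version_of_ae_mem`) and (7.3)
(`SLEBubbles.measure_disjoint_of_thm65`) supplied by the tree.
[cite: LawlerSchrammWerner2003Restriction, Thm. 7.3 (pp. 28–29) and p. 29, with Prop. 3.3] -/
theorem IsRestrictionMeasure.ae_interior_nonempty_of_gt_five_eighths_of_three_leaves
    (hμex : exists_isBrownianBubbleMeasure_ae_interior_nonempty)
    (hcfg : SLEBubbles.ae_mem_restrictionConfigs)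
    (h65 : SLEBubbles.lintegral_poissonAvoidance_eq_rpow) :
    IsRestrictionMeasure.ae_interior_nonempty_of_gt_five_eighths :=
  IsRestrictionMeasure.ae_interior_nonempty_of_gt_five_eighths_of_bubbles' hμex
    exists_isPoissonCloud_holds (SLEBubbles.exists_measurable_version_of_ae_mem hcfg)
    (SLEBubbles.measure_disjoint_of_thm65 h65)

/-- **The existential form from the same three inputs**: for every `α > 5/8` there is a
restriction measure `P_α` almost every sample of which has an interior point
(`exists_isRestrictionMeasure_ae_interior_nonempty`, `RestrictionMeasuresBubbles`).
[cite: LawlerSchrammWerner2003Restriction, Thm. 7.3 and p. 29] -/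
theorem exists_isRestrictionMeasure_ae_interior_nonempty_of_three_leaves
    (hμex : exists_isBrownianBubbleMeasure_ae_interior_nonempty)
    (hcfg : SLEBubbles.ae_mem_restrictionConfigs)
    (h65 : SLEBubbles.lintegral_poissonAvoidance_eq_rpow) :
    exists_isRestrictionMeasure_ae_interior_nonempty :=
  exists_isRestrictionMeasure_ae_interior_nonempty_of_bubbles' hμex exists_isPoissonCloud_holds
    (SLEBubbles.exists_measurable_version_of_ae_mem hcfg) (SLEBubbles.measure_disjoint_of_thm65 h65)

/-- **The `α > 5/8` leaf with input (2) in its printed form**: the bubble measure with interior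
points (`hμex`), the closedness `cl Ξ = Ξ ∪ {0}` of p. 29 (`hcl`), Def. 3.1 (2) for `Ξ` (`hcc`)
and Theorem 6.5 (`h65`). [cite: LawlerSchrammWerner2003Restriction, Thm. 7.3 and end of its proof (p. 29), with Prop. 3.3] -/
theorem IsRestrictionMeasure.ae_interior_nonempty_of_gt_five_eighths_of_closedness
    (hμex : exists_isBrownianBubbleMeasure_ae_interior_nonempty)
    (hcl : ∀ {κ : ℝ≥0}, 0 < κ → κ ≤ 8 / 3 → ∀ {μ : Measure BubbleConfig}, IsBrownianBubbleMeasure μ →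
      ∀ {Ω' : Type} [MeasurableSpace Ω'] {P' : Measure Ω'} {X : Ω' → Set (BubbleConfig × ℝ≥0)},
        IsPoissonCloud (bubbleCloudIntensity κ μ) X P' →
          ∀ᵐ p ∂(preWienerMeasure.prod P'),
            closure (sleBubbleSet κ p.1 (X p.2)) = sleBubbleSet κ p.1 (X p.2) ∪ {0})
    (hcc : ∀ {κ : ℝ≥0}, 0 < κ → κ ≤ 8 / 3 → ∀ {μ : Measure BubbleConfig}, IsBrownianBubbleMeasure μ →
      ∀ {Ω' : Type} [MeasurableSpace Ω'] {P' : Measure Ω'} {X : Ω' → Set (BubbleConfig × ℝ≥0)},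
        IsPoissonCloud (bubbleCloudIntensity κ μ) X P' →
          ∀ᵐ p ∂(preWienerMeasure.prod P'), IsConnected (closure (sleBubbleSet κ p.1 (X p.2)))ᶜ)
    (h65 : SLEBubbles.lintegral_poissonAvoidance_eq_rpow) :
    IsRestrictionMeasure.ae_interior_nonempty_of_gt_five_eighths :=
  IsRestrictionMeasure.ae_interior_nonempty_of_gt_five_eighths_of_three_leaves hμex
    (SLEBubbles.ae_mem_restrictionConfigs_of_closedness hcl hcc) h65

end Literature.Probability.RandomPlanarGeometry

end
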